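import Summits.CriticalPhenomena.Ising3DConformalLimit.Theses.InverseSquareTelemetry
import Summits.CriticalPhenomena.Ising3DConformalLimit.Theorems.InverseSquareTelemetryPowerLawFromTelemetry
import Summits.CriticalPhenomena.Ising3DConformalLimit.Theorems.InverseSquareTelemetryPositiveSolutionAsymptoticsFinal
import Summits.CriticalPhenomena.Ising3DConformalLimit.Theorems.InverseSquareTelemetryEtaBoundsFromTelemetryBarriers
import Summits.CriticalPhenomena.Ising3DConformalLimit.Theorems.InverseSquareTelemetryInverseSquareLawUnitarityFromInfraredBound
import Summits.CriticalPhenomena.Ising3DConformalLimit.Theorems.PerfectScreeningScreeningDichotomyGreen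
import HarnessLib

/-!
# Crux `InverseSquareLaw` (stmt-CriticalPhenomena-4495) — STRATEGY CENSUS r1: typed signatures

Strategist r1 (second opinion after `cstrat-…-s2`), route `InverseSquareTelemetry`, sub-problem
`Ising3DConformalLimit`.  This file is the Lean companion of `STRATEGY-CENSUS.md` (r1).  It contains
NO `sorry`: every open statement is a `def … : Prop`, and the three theorems are proved.

Write `G = criticalTwoPoint 3`, `s(x) = Σᵢ xᵢ²`, `T(x) = s(x)·(Δ_{ℤ³}G)(x)/G(x)` (`telemetry`, verbatim
the expression of the crux).

* §1 `rotInvPowerLaw_of_inverseSquareLaw` — the STRENGTH THEOREM: the crux implies the milestone item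
  `IsingEuclidUpgradeR2RotInvPowerLaw` (stmt-CriticalPhenomena-0634, the rotation-invariant pure power law
  `G(x)|x|^{2Δ} → c`, Duminil-Copin's open problem), by composing the two LANDED route theorems
  `powerLawFromTelemetry_proof` (item 4498) and `positiveSolutionAsymptotics_proof` (item 4496).  So the
  crux is at least as strong as 0634; no converse is known (0634 gives only the axial half of the
  rate-free telemetric limit, `AxialTelemetry.axialTelemetry_of_rotInvPowerLaw`).
* §2 the best typed DECOMPOSITION found (G1): `AxisFullTelemetry` (the crux restricted to the three
  axes) and `AngularTransport` (the telemetry at `x` equals the telemetry at the axis site of the same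
  rounded radius, with a power rate), with the glue `inverseSquareLaw_of_axis_angular` PROVED (triangle
  inequality + the landed unitarity theorem `stub_unitarityFromInfraredBound` for `0 ≤ κ`).  Both pieces
  are strict consequences of the crux; neither is the summit; `AngularTransport` has no plan (census §3).
* §3 typed first rungs of the walls: `BoundedTransverseTelemetryOnAxis` (W1, even this is open),
  `TransverseAxisTelemetry`, `NeighbourRatioToOne` (zeroth-order telemetry off the RP rays, open),
  `GradientLaw` (first-order telemetry; implies 0634, does not imply the crux).
-/

noncomputable section

namespace Summit.CriticalPhenomena.Ising3DConformalLimit.Cruxes.InverseSquareLaw.StrategistR1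

open Filter Topology Literature.Probability.LatticeModels
open Summit.CriticalPhenomena.Ising3DConformalLimit.Theses.InverseSquareTelemetry
open Summit.CriticalPhenomena.Ising3DConformalLimit.Theorems

/-- The telemetry `T(x) = s(x) · (Δ_{ℤ³} G)(x) / G(x)`, verbatim the crux's expression. -/
def telemetry (x : Site 3) : ℝ :=
  (∑ i, ((x i : ℝ)) ^ 2) *
    (((∑ i : Fin 3, (criticalTwoPoint 3 (x + Pi.single i 1) + criticalTwoPoint 3 (x - Pi.single i 1)))
        - 6 * criticalTwoPoint 3 x) / criticalTwoPoint 3 x)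

/-- Euclidean radius `|x|₂ = √s(x)`. -/
def enorm (x : Site 3) : ℝ := Real.sqrt (∑ i, ((x i : ℝ)) ^ 2)

/-! ## §1 Strength theorem: the crux implies the milestone 0634 -/

/-- **`InverseSquareLaw ⟹ IsingEuclidUpgradeR2RotInvPowerLaw`** (crux 4495 ⟹ milestone item 0634), by the
landed route theorems `powerLawFromTelemetry_proof` (4498) and `positiveSolutionAsymptotics_proof` (4496). -/
theorem rotInvPowerLaw_of_inverseSquareLaw (h : InverseSquareLaw) : IsingEuclidUpgradeR2RotInvPowerLaw :=
  powerLawFromTelemetry_proof h positiveSolutionAsymptotics_proof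

/-! ## §2 Decomposition G1: axis telemetry + angular transport -/

/-- **P1 (axis full telemetry with rate).** The crux restricted to the axis sites `n eᵢ`, `n ≠ 0`:
`|T(n eᵢ) − κ| ≤ C |n|^{−ε}`.  On the axis `T = T∥ + T⊥` (`AxialSigns.axis_laplacian_split`); `T∥` follows
with rate from an axial power law with rate (monotone density), `T⊥ = −2n²q(n)/G(neᵢ)` with
`q(n) = 2[G(neᵢ) − G(neᵢ+eⱼ)]` a Hausdorff moment sequence — its asymptotics is wall W1. [this work] -/
def AxisFullTelemetry : Prop :=
  ∃ κ ε C : ℝ, 0 < ε ∧ ∀ (i : Fin 3) (n : ℤ), n ≠ 0 →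
    |telemetry (Pi.single i n) - κ| ≤ C * enorm (Pi.single i n) ^ (-ε)

/-- Rounded radius `⌈|x|₂⌉ ∈ ℤ`. -/
def iradius (x : Site 3) : ℤ := ⌈enorm x⌉

/-- **P2 (angular transport with rate).** The telemetry at `x` equals, up to `O(|x|^{−ε})`, the telemetry at
the axis site `⌈|x|₂⌉ e₀`: lattice isotropy of `T` at second order with a power rate (walls W2+W3). [this work] -/
def AngularTransport : Prop :=
  ∃ ε C : ℝ, 0 < ε ∧ ∀ x : Site 3, x ≠ 0 →
    |telemetry x - telemetry (Pi.single 0 (iradius x))| ≤ C * enorm x ^ (-ε)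

theorem one_le_enorm {x : Site 3} (hx : x ≠ 0) : 1 ≤ enorm x :=
  Real.one_le_sqrt.mpr (PerfectScreening.one_le_sum_sq hx)

theorem enorm_single_zero (n : ℤ) (hn : 0 ≤ n) : enorm (Pi.single 0 n) = (n : ℝ) := by
  have : (∑ j, (((Pi.single (0 : Fin 3) n : Site 3) j : ℝ)) ^ 2) = (n : ℝ) ^ 2 := by
    simp [Pi.single_apply, Finset.sum_ite_eq']
  unfold enorm
  rw [this, Real.sqrt_sq (by exact_mod_cast hn)]

/-- **G1 glue (proved): `AxisFullTelemetry → AngularTransport → InverseSquareLaw`.** Triangle inequality with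
`ε = min ε₁ ε₂`; the sign `0 ≤ κ` is the landed unitarity theorem `stub_unitarityFromInfraredBound`. [this work] -/
theorem inverseSquareLaw_of_axis_angular (h1 : AxisFullTelemetry) (h2 : AngularTransport) :
    InverseSquareLaw := by
  obtain ⟨κ, ε₁, C₁, hε₁, hax⟩ := h1
  obtain ⟨ε₂, C₂, hε₂, hang⟩ := h2
  have hε : 0 < min ε₁ ε₂ := lt_min hε₁ hε₂
  have key : ∀ x : Site 3, x ≠ 0 →
      |telemetry x - κ| ≤ (|C₁| + |C₂|) * enorm x ^ (-(min ε₁ ε₂)) := by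
    intro x hx
    have hr1 : 1 ≤ enorm x := one_le_enorm hx
    have hr0 : 0 < enorm x := lt_of_lt_of_le one_pos hr1
    have hceil : enorm x ≤ (iradius x : ℝ) := Int.le_ceil _
    have hn1 : (1 : ℝ) ≤ (iradius x : ℝ) := hr1.trans hceil
    have hn0' : (0 : ℤ) < iradius x := by exact_mod_cast (one_pos.trans_le hn1)
    have hn0 : iradius x ≠ 0 := ne_of_gt hn0'
    have hA := hax 0 (iradius x) hn0
    rw [enorm_single_zero _ hn0'.le] at hA
    have hB := hang x hx
    have e1 : (iradius x : ℝ) ^ (-ε₁) ≤ enorm x ^ (-ε₁) :=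
      Real.rpow_le_rpow_of_nonpos hr0 hceil (by linarith)
    have e2 : enorm x ^ (-ε₁) ≤ enorm x ^ (-(min ε₁ ε₂)) :=
      Real.rpow_le_rpow_of_exponent_le hr1 (by simp)
    have e3 : enorm x ^ (-ε₂) ≤ enorm x ^ (-(min ε₁ ε₂)) :=
      Real.rpow_le_rpow_of_exponent_le hr1 (by simp)
    have p1 : 0 ≤ (iradius x : ℝ) ^ (-ε₁) := Real.rpow_nonneg (by linarith) _
    have p2 : 0 ≤ enorm x ^ (-ε₂) := Real.rpow_nonneg hr0.le _
    have hA' : |telemetry (Pi.single 0 (iradius x)) - κ| ≤ |C₁| * enorm x ^ (-(min ε₁ ε₂)) :=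
      hA.trans ((mul_le_mul_of_nonneg_right (le_abs_self C₁) p1).trans
        (mul_le_mul_of_nonneg_left (e1.trans e2) (abs_nonneg C₁)))
    have hB' : |telemetry x - telemetry (Pi.single 0 (iradius x))| ≤ |C₂| * enorm x ^ (-(min ε₁ ε₂)) :=
      hB.trans ((mul_le_mul_of_nonneg_right (le_abs_self C₂) p2).trans
        (mul_le_mul_of_nonneg_left e3 (abs_nonneg C₂)))
    calc |telemetry x - κ|
        ≤ |telemetry x - telemetry (Pi.single 0 (iradius x))| + |telemetry (Pi.single 0 (iradius x)) - κ| :=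
          abs_sub_le _ _ _
      _ ≤ |C₂| * enorm x ^ (-(min ε₁ ε₂)) + |C₁| * enorm x ^ (-(min ε₁ ε₂)) := add_le_add hB' hA'
      _ = (|C₁| + |C₂|) * enorm x ^ (-(min ε₁ ε₂)) := by ring
  have hev : ∀ᶠ x : Site 3 in cofinite,
      |telemetry x - κ| ≤ (|C₁| + |C₂|) * enorm x ^ (-(min ε₁ ε₂)) := by
    refine Filter.eventually_cofinite.2 ((Set.finite_singleton (0 : Site 3)).subset ?_)
    intro x hx
    by_contra h0
    exact hx (key x h0)
  have hκ : 0 ≤ κ := stub_unitarityFromInfraredBound κ (min ε₁ ε₂) (|C₁| + |C₂|) hε hev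
  unfold InverseSquareLaw
  exact ⟨κ, min ε₁ ε₂, |C₁| + |C₂|, hκ, hε, key⟩

/-- Both pieces are CONSEQUENCES of the crux (so G1 loses nothing): P1 is the restriction to the axes. [this work] -/
theorem axisFullTelemetry_of_inverseSquareLaw (h : InverseSquareLaw) : AxisFullTelemetry := by
  obtain ⟨κ, ε, C, -, hε, hb⟩ := h
  refine ⟨κ, ε, C, hε, fun i n hn => ?_⟩
  have hx : (Pi.single i n : Site 3) ≠ 0 := by
    intro h0
    have := congrFun h0 i
    simp at this
    exact hn this
  exact hb _ hx

/-! ## §3 Typed first rungs of the walls (all OPEN; no sorry — they are `Prop`s) -/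

/-- **W1, rung 0 (bounded transverse telemetry on the axis).** `n²[G(neᵢ) − G(neᵢ+eⱼ)] ≤ C·G(neᵢ)`:
the transverse one-step decrement of `G` at an axis site is `O(n⁻²)` relative.  Known: only `O(n⁻¹)`
relative (Messager–Miracle-Solé diagonal mirror `G(neᵢ+eⱼ) ≥ G((n+1)eᵢ)` + complete monotonicity of the
axis sequence).  OPEN; it would follow from a ballistic lattice spectrum condition `m(p) ≥ c|p|` for the
momentum-resolved spectral edge of the critical transfer matrix (census §1). [this work] -/
def BoundedTransverseTelemetryOnAxis : Prop :=
  ∃ C : ℝ, ∀ (i j : Fin 3), j ≠ i → ∀ n : ℕ, 1 ≤ n →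
    (n : ℝ) ^ 2 * (criticalTwoPoint 3 (Pi.single i (n : ℤ))
        - criticalTwoPoint 3 (Pi.single i (n : ℤ) + Pi.single j 1))
      ≤ C * criticalTwoPoint 3 (Pi.single i (n : ℤ))

/-- **W1, rung 1 (transverse axis telemetry).** `n²[G(neᵢ) − G(neᵢ+eⱼ)]/G(neᵢ) → a/2` with `a` the axial
exponent (`G(neᵢ)nᵃ → c`): the irreducible content of stub S1 beyond item 0634 on the axis
(`AxialTelemetry.axialTelemetry_of_rotInvPowerLaw`, docstring).  OPEN. [this work] -/
def TransverseAxisTelemetry : Prop :=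
  ∃ a c : ℝ, 0 < c ∧
    (∀ i : Fin 3, Tendsto (fun n : ℕ => criticalTwoPoint 3 (Pi.single i (n : ℤ)) * (n : ℝ) ^ a)
      atTop (𝓝 c)) ∧
    ∀ (i j : Fin 3), j ≠ i →
      Tendsto (fun n : ℕ => (n : ℝ) ^ 2 * (criticalTwoPoint 3 (Pi.single i (n : ℤ))
          - criticalTwoPoint 3 (Pi.single i (n : ℤ) + Pi.single j 1))
          / criticalTwoPoint 3 (Pi.single i (n : ℤ))) atTop (𝓝 (a / 2))

/-- **W2, rung 0 (zeroth-order telemetry off the RP rays).** Nearest-neighbour ratios of `G` tend to `1`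
cofinitely.  Known on the axes (complete monotonicity + `G(neᵢ) ≥ c n⁻²`), on the nine mirror ray families
at first order; OPEN for generic directions (it is implied by 0634 and by the doubling-type regularity
`TwoPointDoubling`, stmt-CriticalPhenomena-6150, also open). [this work] -/
def NeighbourRatioToOne : Prop :=
  ∀ i : Fin 3, Tendsto (fun x : Site 3 => criticalTwoPoint 3 (x + Pi.single i 1) / criticalTwoPoint 3 x)
    cofinite (𝓝 1)

/-- **First-order telemetry with rate (`GradientLaw`).** `G(x+eᵢ)/G(x) = 1 − a xᵢ/s(x) + O(|x|^{−1−ε})`: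
the discrete logarithmic GRADIENT of `G` is the isotropic inverse-first-power field.  It implies item 0634
(sum the logarithmic increments along a monotone lattice path from the axis; the error sums to
`O(|x|^{−ε})`), but NOT the crux (second differences of the `O(|x|^{−1−ε})` remainder are not `o(|x|⁻²)`);
its second-order sharpening (`… + bᵢ(x)/s(x)² + O(|x|^{−2−ε})`) is STRONGER than the crux.  No level of
this neighbour-ratio hierarchy sits strictly between 0634 and the crux (census §2). [this work] -/
def GradientLaw : Prop :=
  ∃ a ε C : ℝ, 0 < ε ∧ ∀ x : Site 3, x ≠ 0 → ∀ i : Fin 3,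
    |criticalTwoPoint 3 (x + Pi.single i 1) / criticalTwoPoint 3 x - 1 + a * (x i : ℝ) / (∑ j, ((x j : ℝ)) ^ 2)|
      ≤ C * enorm x ^ (-(1 + ε))

end Summit.CriticalPhenomena.Ising3DConformalLimit.Cruxes.InverseSquareLaw.StrategistR1
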